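/-
Copyright (c) 2026 the pub-hodgecm-mathlib formalisation cell (harness21).  Prover seat hodgecm-mathlib-K2Liu-p13 (g4), Track B «K2-LIT»,
#184♮ = hLiu418 = `stmt-HodgeConjecture-24832`; ROAD Φ (RULING «M-156n»), #41 TOP — THE (β) END FILE, EDITION 1: the big-cell continuation letter `(E, hEd, hEeq)` of the
#41 TOP (`(b^S∕a^S)(s)·M(s)f_s(x)` is holomorphic on `{0 < re}`) for EVERY standard datum and standard family, HYPOTHESIS-FIRST on exactly ONE named input — the archimedean
face `hArch` (K2Liu-p11's (E8) END lemma over ★ p862454∕p862080) — with every other letter BY NAME: ★ E3 p861928, ★ (F-GK-4) ED. 3 p862469, ★ (E6′) p862350, ★ (E9) p862520,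
★ (E10) `K2LiuBigCellLocalFace`, ★ (E10a) p862458, ★ Fubini p862082, ★ Tail p862179, ★ E7′∕E7″ p862117, ★ assembly p862168, ★ reduction p861688∕p861729∕p862134.
THEOREMS ONLY (no `def`, no `instance`, no named-fact hypothesis, no `sorry`).
-/
import Summits.HodgeConjecture.HodgeConjecture.Theorems.K2LiuBigCellEulerHead                 -- ★ E3 `exists_eulerHead_intertwiningDelta`
import Summits.HodgeConjecture.HodgeConjecture.Theorems.K2LiuSphericalSiegelValueCM             -- ★ (F-GK-4) ED. 3 `exists_finset_forall_integral_lambdaLoc_weylDelta_eq_localScalar`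
import Summits.HodgeConjecture.HodgeConjecture.Theorems.K2LiuBigCellLocalFace                  -- ★ (E10) `exists_localFace`, `integrable_localFace`, `heightTwistLoc_flat` (+ ★ E6′, E9, E10c, A7)
import Summits.HodgeConjecture.HodgeConjecture.Theorems.K2LiuStdDatumFinsetAdapted             -- ★ (E10a) `exists_isStd_adaptedEverywhere`
import Summits.HodgeConjecture.HodgeConjecture.Theorems.K2LiuUnipDeltaLocHaarNormalised        -- ★ p862154 `exists_family_isHaarMeasure_inH_eq_one`
import Summits.HodgeConjecture.HodgeConjecture.Theorems.K2LiuBigCellEulerFaceAssembly          -- ★ p862168 `eulerFace_of_letters'` (+ ★ Fubini p862082)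
import Summits.HodgeConjecture.HodgeConjecture.Theorems.K2LiuBigCellTailScalar                 -- ★ p862179 `invScalar_mul_tprod_eq_finsetProd_cm`
import Summits.HodgeConjecture.HodgeConjecture.Theorems.K2LiuBigCellContinuationOfFacesSum      -- ★ p862134 `exists_pointContinuation_of_facesSum` (+ ★ p861688 reduction)
import HarnessLib

/-!
# Crux `HLiu418`, ROAD Φ, organ Φ8 (row G6): THE (β) END FILE — `(b^S∕a^S)(s)·M(s)f_s(x)` CONTINUES HOLOMORPHICALLY TO `{0 < re s}`, MODULO THE ARCHIMEDEAN FACE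

Cell `hodgecm-mathlib`, crux item hLiu418 = `stmt-HodgeConjecture-24832` (helper lane, count-neutral).  The doubled CM datum `H = U(𝕎 ⊕ −𝕎)` with `rank 𝕎 = n = 2`, a STANDARD
Iwasawa datum `𝒦`, `χ = toHeckeCharacter L lam⁻¹` with `lam` conjugate-symplectic, a `𝒦`-standard continuous family `f`, `S = S_ε` EXACTLY the ramification set of
`ε = ε_{L∕L⁺}` (`hur` off `S`, `hram` on `S` — the (β) census v2 §0 flag: with an `ε`-unramified place inside `S` the statement is false).
**`exists_bigCell_continuation_cm`**: modulo ONE by-value letter `hArch` (the archimedean face: integrability on `{1 < re}` and holomorphy on `{0 < re}` of the arch block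
`∫ F_s(w_Δ p κ_∞) dν_∞(p)` of every (E6′) arch flat family `F_s = H_∞^{2(s−s₀)}·A` over every standard datum — K2Liu-p11's (E8) END lemma), there is
`E : ℂ → H(𝔸) → ℂ` with `s ↦ E s x` holomorphic on `{0 < re}` and `E s x = (b^S∕a^S)(s)·M(s)f_s(x)` for `re s > n∕2` — the `(E, hEd, hEeq)` of ★ p861474
`exists_bigCell_termPackage_cm` ∕ the TOP.  ROUTE (per `κ ∈ 𝒦⁺.K`, ★ reduction p861688): adapted datum `𝒦⁺ ⊇ 𝒦` (★ (E10a)); Euler head at `T ⊇ T₀(κ) ∪ S₀ ∪ T₁ ∪ S`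
(★ E3); tail `= ∏_{v∈T∖S} c_v⁻¹` (★ (F-GK-4) ED. 3 + ★ Tail); slice as a flat sum of pure tensors (★ (E6′)); Fubini (★ p862082) with per-factor integrability (`hArch`, ★ (E9));
local values `aNorm_v·Fn` with `Fn` `q_v`-rational (★ (E10) over ★ A7-AllS0); arch values `E_i(s)` (`hArch`); scalar bookkeeping ★ p862168 `eulerFace_of_letters'`, the letters
`c_v⁻¹·aNorm_v = m_v` (★ E7″) at `v ∈ T∖S` and `aNorm_v` (★ E7′) at `v ∈ S`; point continuation ★ `exists_pointContinuation_of_facesSum`.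
Sources: [Tan1999, §3]; [KudlaRallis1994, §1–§2]; [KudlaSweet1997, §1]; [HarrisKudlaSweet1996, §6 (6.14)–(6.16)]; [Liu2011, §2B–§2C]; [MoeglinWaldspurger1995, II.1.7, IV.1.8].
HONEST LABEL.  Helper lemmas, count-neutral; `HC_CM` is proved only modulo the 7 printed citations (2 remaining named inputs:
hLiu418 = `stmt-HodgeConjecture-24832`, h413 = `stmt-HodgeConjecture-24833`) until rung 0 closes.
-/

set_option autoImplicit false
set_option linter.dupNamespace false -- the mandated namespace repeats `HodgeConjecture.HodgeConjecture`

noncomputable section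

open scoped NNReal ENNReal Topology
open NumberField IsDedekindDomain MeasureTheory Measure Filter Set
open Literature.NumberTheory.Automorphic Literature.NumberTheory.Automorphic.UnitaryGroup Literature.NumberTheory.GaloisRepresentations
open Literature.NumberTheory.GaloisRepresentations.IsNonarchimedeanLocalField (residueFieldCard residueFieldCard_ne_zero)
open Literature.NumberTheory.GelbartRogawski1991 Literature.NumberTheory.GelbartRogawski1991.GRConstruction
open Literature.NumberTheory.GelbartRogawski1991.UnitaryDualPair
open Literature.NumberTheory.K2Lit Literature.NumberTheory.K2Lit.SiegelDoubled Literature.NumberTheory.K2Lit.PlaceSplitting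
open Literature.NumberTheory.Automorphic.IdeleClassGroup Literature.NumberTheory.LFunctions
open Literature.MeasureTheory.RestrictedProduct
open Literature.Topology.Algebra.RestrictedProduct (inH)
open Summit.HodgeConjecture.HodgeConjecture.Cruxes.HLiu418.K2LiuQRationalDefs (IsQRationalRegularAt)
open Summit.HodgeConjecture.HodgeConjecture.Cruxes.HLiu418.K2LiuLocalLFactorDefs (aNorm)
open Summit.HodgeConjecture.HodgeConjecture.Cruxes.HLiu418.K2LiuSiegelUnipotentLocalDefs
open Summit.HodgeConjecture.HodgeConjecture.Cruxes.HLiu418.K2LiuSiegelUnipotentSplitDefs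
open Summit.HodgeConjecture.HodgeConjecture.Cruxes.HLiu418.K2LiuSiegelUnipotentSplitAtDefs
open Summit.HodgeConjecture.HodgeConjecture.Cruxes.HLiu418.K2LiuSiegelUnipotentFourierDefs
open Summit.HodgeConjecture.HodgeConjecture.Cruxes.HLiu418.K2LiuBigCellEulerHead (exists_eulerHead_intertwiningDelta)
open Summit.HodgeConjecture.HodgeConjecture.Cruxes.HLiu418.K2LiuSphericalSiegelValueCM (exists_finset_forall_integral_lambdaLoc_weylDelta_eq_localScalar)
open Summit.HodgeConjecture.HodgeConjecture.Cruxes.HLiu418.K2LiuBigCellLocalFace (exists_localFace integrable_localFace heightTwistLoc_flat)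
open Summit.HodgeConjecture.HodgeConjecture.Cruxes.HLiu418.K2LiuStdDatumFinsetAdapted (exists_isStd_adaptedEverywhere)
open Summit.HodgeConjecture.HodgeConjecture.Cruxes.HLiu418.K2LiuUnipDeltaLocHaarNormalised (exists_family_isHaarMeasure_inH_eq_one)
open Summit.HodgeConjecture.HodgeConjecture.Cruxes.HLiu418.K2LiuBigCellEulerFaceAssembly (eulerFace_of_letters')
open Summit.HodgeConjecture.HodgeConjecture.Cruxes.HLiu418.K2LiuBigCellTailScalar (invScalar_mul_tprod_eq_finsetProd_cm)
open Summit.HodgeConjecture.HodgeConjecture.Cruxes.HLiu418.K2LiuBigCellContinuationOfFacesSum (exists_pointContinuation_of_facesSum)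
open Summit.HodgeConjecture.HodgeConjecture.Cruxes.HLiu418.K2LiuBigCellContinuationReduction (exists_continuation_of_isStandardSectionFamily_pointwise)
open Summit.HodgeConjecture.HodgeConjecture.Cruxes.HLiu418.K2LiuStdFamilyAwayPurityFlat (exists_awayPurity_flat heightTwistLoc_siegel heightTwistLoc_smooth)
open Summit.HodgeConjecture.HodgeConjecture.Cruxes.HLiu418.K2LiuSiegelNormaliserTwoOfRecord
  (invLocalScalar_mul_aNorm_two_eq_of_record differentiableOn_modifiedNormaliser_of_record differentiableOn_aNorm_two_of_record_of_ramified)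

namespace Summit.HodgeConjecture.HodgeConjecture.Cruxes.HLiu418.K2LiuBigCellContinuation

/-! ## §0 Two bookkeeping lemmas -/

/-- re-indexing an unconditional product along equivalent subtypes: `(∀ a, p a ↔ q a) → ∏' a : {a // p a}, J a = ∏' a : {a // q a}, J a`. [folklore] -/
theorem tprod_subtype_congr {α M : Type*} [CommMonoid M] [TopologicalSpace M] {p q : α → Prop} (h : ∀ a, p a ↔ q a) (J : α → M) :
    ∏' a : {a // p a}, J a.1 = ∏' a : {a // q a}, J a.1 :=
  Equiv.tprod_eq (Equiv.subtypeEquivRight h) (fun b : {a // q a} => J b.1)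

/-- the modified normaliser at an `ε`-unramified place as an EXISTENTIAL letter: a function `m` holomorphic on `{0 < re}` with `c_v(s)⁻¹ · aNorm_v(vol)(s) = m(s)` for
`re s > ½` (★ E7″ of record: `differentiableOn_modifiedNormaliser_of_record`, `invLocalScalar_mul_aNorm_two_eq_of_record`). [cite: HarrisKudlaSweet1996, §6 (6.16)] [cite: Tan1999, §3] -/
theorem exists_modifiedNormaliser (L : Type) [Field L] [NumberField L] [IsCMField L] (v : HeightOneSpectrum (𝓞 ↥(maximalRealSubfield L)))
    {lam : IdeleClassGroup L →ₜ* Circle} (hlam : IsConjugateSymplectic L lam) (hur : (quadraticHeckeCharCM L).IsUnramifiedAt v) (vol : ℝ) :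
    ∃ m : ℂ → ℂ, DifferentiableOn ℂ m {s : ℂ | 0 < s.re} ∧ ∀ s : ℂ, 1 / 2 < s.re →
      ((1 - (v.residueCard : ℂ) ^ (-(2 * s))) * (1 - (quadraticHeckeCharCM L).valueAtUniformizer v * (v.residueCard : ℂ) ^ (-(2 * s - 1)))) /
            ((1 - (v.residueCard : ℂ) ^ (-(2 * s + 1))) * (1 - (quadraticHeckeCharCM L).valueAtUniformizer v * (v.residueCard : ℂ) ^ (-(2 * s + 2)))) *
          aNorm ↥(maximalRealSubfield L) L (IsCMField.complexConj L : L ≃ₐ[↥(maximalRealSubfield L)] L) v 2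
            (fun w : PlacesOver L v => (toHeckeCharacter L lam⁻¹).localComponent w.1) vol s = m s :=
  ⟨_, differentiableOn_modifiedNormaliser_of_record L v lam vol, fun _ hs => invLocalScalar_mul_aNorm_two_eq_of_record L v hlam hur vol hs⟩

/-! ## §1 The (β) END: the big-cell continuation letter modulo the archimedean face -/

variable (L : Type) [Field L] [NumberField L] [IsCMField L]
variable {N₀ M₀ n : ℕ} (e : Fin N₀ × Fin M₀ ≃ Fin n)
  (dV : Fin N₀ → L) (hdV : ∀ i, IsCMField.complexConj L (dV i) = dV i)
  (dW : Fin M₀ → L) (hdW : ∀ i, IsCMField.complexConj L (dW i) = dW i)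

set_option maxHeartbeats 1600000 in -- MEASURED: 200 000 ✗ (`whnf` on the statement), 800 000 ✗ (`whnf` inside the ★ p862168 application); 1 600 000 ✓ — ★ E3∕(E10)∕(E6′)-class telescope assembled at one point (plain `obtain`∕`refine`∕`rw`∕`choose`, no search)
/-- **THE (β) BIG-CELL CONTINUATION LETTER OF THE #41 TOP, MODULO THE ARCHIMEDEAN FACE.**  `n = 2`; `𝒦` standard; `χ = toHeckeCharacter L lam⁻¹`, `lam` conjugate-symplectic;
`f` a `𝒦`-standard continuous family; `S` finite with `ε_{L∕L⁺}` unramified EXACTLY off `S`.  Modulo `hArch` (for every standard datum `𝒦′`, every (E6′) arch datum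
`(s₀, A)` — arch Siegel law at `s₀`, `K_∞`-finite w.r.t. `𝒦′`, continuous — every `κ ∈ 𝒦′.K` and every σ-finite Haar `ν_∞` on `N_Δ(L⁺ ⊗ ℝ)`: the arch block
`p ↦ H_∞(w_Δ p κ_∞)^{2(s−s₀)} A(w_Δ p κ_∞)` is `ν_∞`-integrable for `1 < re s` and its integral is a holomorphic function of `s` on `{0 < re}`):
`∃ E`, `s ↦ E s x` holomorphic on `{0 < re s}` for every `x ∈ H(𝔸)`, and `E s x = (L^S(2s+1)L^S(2s+2,ε))∕(L^S(2s)L^S(2s−1,ε)) · M(s)f_s(x)` for `re s > n∕2`.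
[cite: Tan1999, §3] [cite: KudlaRallis1994, §1–§2] [cite: KudlaSweet1997, §1] [cite: HarrisKudlaSweet1996, §6 (6.14)–(6.16)] [cite: Liu2011, §2B–§2C] -/
theorem exists_bigCell_continuation_cm (hn : n = 2) (hdV0 : ∀ i, dV i ≠ 0) (hdW0 : ∀ i, dW i ≠ 0)
    (𝒦 : IwasawaDatum L e dV hdV dW hdW) (h𝒦 : 𝒦.IsStd)
    [MeasurableSpace (unipDelta L e dV hdV dW hdW)] [BorelSpace (unipDelta L e dV hdV dW hdW)]
    (νN : Measure (unipDelta L e dV hdV dW hdW)) [νN.IsHaarMeasure]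
    {lam : IdeleClassGroup L →ₜ* Circle} (hlam : IsConjugateSymplectic L lam)
    {f : ℂ → HA L e dV hdV dW hdW → ℂ} (hstd : IsStandardSectionFamily 𝒦 (toHeckeCharacter L lam⁻¹) f) (hcont : ∀ s, Continuous (f s))
    {S : Set (HeightOneSpectrum (𝓞 ↥(maximalRealSubfield L)))} (hS : S.Finite)
    (hur : ∀ v, v ∉ S → (quadraticHeckeCharCM L).IsUnramifiedAt v) (hram : ∀ v ∈ S, ¬ (quadraticHeckeCharCM L).IsUnramifiedAt v)
    -- THE ARCHIMEDEAN FACE, by value ((E8) END lemma, K2Liu-p11)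
    (hArch : ∀ (𝒦' : IwasawaDatum L e dV hdV dW hdW), 𝒦'.IsStd →
      ∀ (s₀ : ℂ) (A : UnitaryGroup.arch (Fp L) L (IsCMField.complexConj L) (n + n) (hermD L e dV hdV dW hdW) → ℂ),
        (∀ p : HA L e dV hdV dW hdW, IsSiegelDelta L e dV hdV dW hdW p → UnitaryGroup.finPart (Fp L) L (IsCMField.complexConj L) (n + n) (hermD L e dV hdV dW hdW) p = 1 →
          ∀ x : UnitaryGroup.arch (Fp L) L (IsCMField.complexConj L) (n + n) (hermD L e dV hdV dW hdW),
            A (UnitaryGroup.archPart (Fp L) L (IsCMField.complexConj L) (n + n) (hermD L e dV hdV dW hdW) p * x) = siegelDeltaCharacter L e dV hdV dW hdW (toHeckeCharacter L lam⁻¹) s₀ p * A x) →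
        (∃ V : Submodule ℂ (UnitaryGroup.arch (Fp L) L (IsCMField.complexConj L) (n + n) (hermD L e dV hdV dW hdW) → ℂ), FiniteDimensional ℂ V ∧ A ∈ V ∧
          ∀ a₀ : UnitaryGroup.arch (Fp L) L (IsCMField.complexConj L) (n + n) (hermD L e dV hdV dW hdW),
            (UnitaryGroup.archToAdelic (Fp L) L (IsCMField.complexConj L) (n + n) (hermD L e dV hdV dW hdW) a₀ : HA L e dV hdV dW hdW) ∈ 𝒦'.K → ∀ G ∈ V, (fun x => G (x * a₀)) ∈ V) →
        Continuous A →
        ∀ κ : HA L e dV hdV dW hdW, κ ∈ 𝒦'.K →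
          ∀ {_ : MeasurableSpace ↥(unipDeltaArch L e dV hdV dW hdW)} [BorelSpace ↥(unipDeltaArch L e dV hdV dW hdW)]
            (νinf : Measure ↥(unipDeltaArch L e dV hdV dW hdW)) [νinf.IsHaarMeasure] [SigmaFinite νinf],
            (∀ s : ℂ, 1 < s.re → Integrable (fun p : ↥(unipDeltaArch L e dV hdV dW hdW) =>
              ((modDelta L e dV hdV dW hdW (𝒦'.pPart (UnitaryGroup.archToAdelic (Fp L) L (IsCMField.complexConj L) (n + n) (hermD L e dV hdV dW hdW)
                  (UnitaryGroup.archPart (Fp L) L (IsCMField.complexConj L) (n + n) (hermD L e dV hdV dW hdW) (weylDelta L e dV hdV dW hdW) *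
                    (p : UnitaryGroup.arch (Fp L) L (IsCMField.complexConj L) (n + n) (hermD L e dV hdV dW hdW)) *
                    UnitaryGroup.archPart (Fp L) L (IsCMField.complexConj L) (n + n) (hermD L e dV hdV dW hdW) κ))) : ℝ) : ℂ) ^ (2 * (s - s₀)) *
                A (UnitaryGroup.archPart (Fp L) L (IsCMField.complexConj L) (n + n) (hermD L e dV hdV dW hdW) (weylDelta L e dV hdV dW hdW) *
                    (p : UnitaryGroup.arch (Fp L) L (IsCMField.complexConj L) (n + n) (hermD L e dV hdV dW hdW)) *
                    UnitaryGroup.archPart (Fp L) L (IsCMField.complexConj L) (n + n) (hermD L e dV hdV dW hdW) κ)) νinf) ∧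
            ∃ Ea : ℂ → ℂ, DifferentiableOn ℂ Ea {s : ℂ | 0 < s.re} ∧ ∀ s : ℂ, 1 < s.re →
              ∫ p : ↥(unipDeltaArch L e dV hdV dW hdW),
                ((modDelta L e dV hdV dW hdW (𝒦'.pPart (UnitaryGroup.archToAdelic (Fp L) L (IsCMField.complexConj L) (n + n) (hermD L e dV hdV dW hdW)
                  (UnitaryGroup.archPart (Fp L) L (IsCMField.complexConj L) (n + n) (hermD L e dV hdV dW hdW) (weylDelta L e dV hdV dW hdW) *
                    (p : UnitaryGroup.arch (Fp L) L (IsCMField.complexConj L) (n + n) (hermD L e dV hdV dW hdW)) *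
                    UnitaryGroup.archPart (Fp L) L (IsCMField.complexConj L) (n + n) (hermD L e dV hdV dW hdW) κ))) : ℝ) : ℂ) ^ (2 * (s - s₀)) *
                A (UnitaryGroup.archPart (Fp L) L (IsCMField.complexConj L) (n + n) (hermD L e dV hdV dW hdW) (weylDelta L e dV hdV dW hdW) *
                    (p : UnitaryGroup.arch (Fp L) L (IsCMField.complexConj L) (n + n) (hermD L e dV hdV dW hdW)) *
                    UnitaryGroup.archPart (Fp L) L (IsCMField.complexConj L) (n + n) (hermD L e dV hdV dW hdW) κ) ∂νinf = Ea s) :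
    ∃ E : ℂ → HA L e dV hdV dW hdW → ℂ,
      (∀ x : HA L e dV hdV dW hdW, DifferentiableOn ℂ (fun s : ℂ => E s x) {s : ℂ | 0 < s.re}) ∧
      (∀ (s : ℂ) (x : HA L e dV hdV dW hdW), (n : ℝ) / 2 < s.re →
        E s x = (partialStandardL S (fun _ => {1}) (2 * s + 1) * partialStandardL S (fun v => {(quadraticHeckeCharCM L).valueAtUniformizer v}) (2 * s + 2)) /
            (partialStandardL S (fun _ => {1}) (2 * s) * partialStandardL S (fun v => {(quadraticHeckeCharCM L).valueAtUniformizer v}) (2 * s - 1)) *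
          intertwiningDelta L e dV hdV dW hdW νN (f s) x) := by
  subst hn
  classical
  -- Borel structures on the local and archimedean unipotent groups (not visible in the statement)
  letI : ∀ v : HeightOneSpectrum (𝓞 (Fp L)), MeasurableSpace ↥(unipDeltaLoc L e dV hdV dW hdW v) := fun v => borel _
  haveI : ∀ v : HeightOneSpectrum (𝓞 (Fp L)), BorelSpace ↥(unipDeltaLoc L e dV hdV dW hdW v) := fun v => ⟨rfl⟩
  letI : MeasurableSpace ↥(unipDeltaArch L e dV hdV dW hdW) := borel _
  haveI : BorelSpace ↥(unipDeltaArch L e dV hdV dW hdW) := ⟨rfl⟩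
  have hχu : (toHeckeCharacter L lam⁻¹).IsUnitary := isUnitary_toHeckeCharacter L lam⁻¹
  -- ★ (E10a): the adapted datum `𝒦⁺ ⊇ 𝒦`, standard, carrying `f`, with a compact open Iwasawa `K₀ v`, `ι_v(K₀ v) ⊆ 𝒦⁺.K`, at EVERY place
  obtain ⟨𝒦', h𝒦', -, hstd', hK₀⟩ := exists_isStd_adaptedEverywhere L e dV hdV hdV0 dW hdW hdW0 h𝒦 hstd hcont
  choose K₀ hK₀c hK₀o hIw hK₀K using hK₀
  -- ★ p862154: normalised local Haar measures `ν_v(K_{H,v} ∩ N_Δ) = 1`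
  obtain ⟨νv, hνv, hσv, hνK⟩ := exists_family_isHaarMeasure_inH_eq_one L e dV hdV dW hdW
  haveI : ∀ v, (νv v).IsHaarMeasure := hνv
  haveI : ∀ v, SigmaFinite (νv v) := hσv
  -- ★ (F-GK-4) ED. 3: the spherical Gindikin–Karpelevich value off `T₁`
  obtain ⟨T₁, hT₁⟩ := exists_finset_forall_integral_lambdaLoc_weylDelta_eq_localScalar L e dV hdV dW hdW hdV0 hdW0 hlam
  -- ★ (E6′): away purity as a flat family on the slice, for `𝒦⁺`, at `s₀ := 0`
  obtain ⟨S₀, hS₀⟩ := exists_awayPurity_flat L e dV hdV hdV0 dW hdW hdW0 h𝒦' hstd' hcont 0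
  -- ★ reduction to the points of `𝒦⁺.K`
  refine exists_continuation_of_isStandardSectionFamily_pointwise L e dV hdV dW hdW hdV0 hdW0 𝒦' νN (toHeckeCharacter L lam⁻¹) (((2 : ℕ) : ℝ) / 2) hstd'
    (fun s : ℂ => (partialStandardL S (fun _ => {1}) (2 * s + 1) * partialStandardL S (fun v => {(quadraticHeckeCharCM L).valueAtUniformizer v}) (2 * s + 2)) /
      (partialStandardL S (fun _ => {1}) (2 * s) * partialStandardL S (fun v => {(quadraticHeckeCharCM L).valueAtUniformizer v}) (2 * s - 1)))
    fun k hk => ?_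
  -- ★ E3 at the point `k`
  obtain ⟨T₀, hT₀⟩ := exists_eulerHead_intertwiningDelta L e dV hdV dW hdW hdV0 hdW0 h𝒦' hχu hstd' hcont k
  -- the finite set `T ⊇ T₀ ∪ S₀ ∪ T₁ ∪ S` and its part `P = T ∖ S`
  obtain ⟨T, hT⟩ : ∃ T : Finset (HeightOneSpectrum (𝓞 (Fp L))), T = T₀ ∪ S₀ ∪ T₁ ∪ hS.toFinset := ⟨_, rfl⟩
  have hT₀T : T₀ ⊆ T := fun v hv => by rw [hT]; simp only [Finset.mem_union]; exact Or.inl (Or.inl (Or.inl hv))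
  have hS₀T : S₀ ⊆ T := fun v hv => by rw [hT]; simp only [Finset.mem_union]; exact Or.inl (Or.inl (Or.inr hv))
  have hT₁T : T₁ ⊆ T := fun v hv => by rw [hT]; simp only [Finset.mem_union]; exact Or.inl (Or.inr hv)
  have hST : ∀ v ∈ S, v ∈ T := fun v hv => by rw [hT]; simp only [Finset.mem_union]; exact Or.inr ((Set.Finite.mem_toFinset hS).2 hv)
  obtain ⟨P, hP⟩ : ∃ P : Finset (HeightOneSpectrum (𝓞 (Fp L))), P = T.filter fun v => v ∉ S := ⟨_, rfl⟩
  have hPT : P ⊆ T := by rw [hP]; exact Finset.filter_subset _ _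
  have hPS : ∀ v ∈ P, v ∉ S := fun v hv => by rw [hP, Finset.mem_filter] at hv; exact hv.2
  have hmemP : ∀ v ∈ T, v ∉ S → v ∈ P := fun v hv hvS => by rw [hP, Finset.mem_filter]; exact ⟨hv, hvS⟩
  have hTSP : ∀ v, v ∉ T ↔ v ∉ S ∪ (↑P : Set (HeightOneSpectrum (𝓞 (Fp L)))) := by
    intro v
    simp only [Set.mem_union, Finset.mem_coe, not_or]
    refine ⟨fun hv => ⟨fun h => hv (hST v h), fun h => hv (hPT h)⟩, fun h hv => ?_⟩
    by_cases hvS : v ∈ S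
    · exact h.1 hvS
    · exact h.2 (hmemP v hv hvS)
  -- ★ E3's identity at `T`, ★ (E6′)'s data at `T`
  obtain ⟨νinf, hνinf, hσinf, hM⟩ := hT₀ T hT₀T νN νv fun v _ => hνK v
  haveI := hνinf
  haveI := hσinf
  obtain ⟨-, -, m, b, A, hb, hfin, hAc, hAsieg, -, hslice⟩ := hS₀ T hS₀T
  -- THE LOCAL FACES at `v ∈ T` (★ (E10) over ★ A7-AllS0, ★ (E9), ★ (E6′) letters, flat on `K₀ v`)
  have face : ∀ (i : Fin m) (v : HeightOneSpectrum (𝓞 (Fp L))),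
      ∃ Fn : ℂ → UnitaryGroup.localPi L (IsCMField.complexConj L) (2 + 2) (hermD L e dV hdV dW hdW) v → ℂ, v ∈ T →
        (∀ s₁ : ℂ, 0 < s₁.re → ∀ h, IsQRationalRegularAt (residueFieldCard (v.adicCompletion (Fp L))) s₁ (fun s => Fn s h)) ∧
        ∀ s : ℂ, 1 < s.re → ∀ h : UnitaryGroup.localPi L (IsCMField.complexConj L) (2 + 2) (hermD L e dV hdV dW hdW) v,
          ∫ y : ↥(unipDeltaLoc L e dV hdV dW hdW v),
              ((modDelta L e dV hdV dW hdW (𝒦'.pPart (locToAdelic L e dV hdV dW hdW v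
                  (UnitaryGroup.evalPlace (Fp L) L (IsCMField.complexConj L) (2 + 2) (hermD L e dV hdV dW hdW) v
                      (UnitaryGroup.finPart (Fp L) L (IsCMField.complexConj L) (2 + 2) (hermD L e dV hdV dW hdW) (weylDelta L e dV hdV dW hdW)) *
                    (y : UnitaryGroup.localPi L (IsCMField.complexConj L) (2 + 2) (hermD L e dV hdV dW hdW) v) * h))) : ℝ) : ℂ) ^ (2 * (s - 0)) *
                b i v (UnitaryGroup.evalPlace (Fp L) L (IsCMField.complexConj L) (2 + 2) (hermD L e dV hdV dW hdW) v
                      (UnitaryGroup.finPart (Fp L) L (IsCMField.complexConj L) (2 + 2) (hermD L e dV hdV dW hdW) (weylDelta L e dV hdV dW hdW)) *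
                    (y : UnitaryGroup.localPi L (IsCMField.complexConj L) (2 + 2) (hermD L e dV hdV dW hdW) v) * h) ∂(νv v) =
            aNorm (Fp L) L (IsCMField.complexConj L) v 2 (fun w : PlacesOver L v => (toHeckeCharacter L lam⁻¹).localComponent w.1)
                ((νv v).real {y : ↥(unipDeltaLoc L e dV hdV dW hdW v) | (y : UnitaryGroup.localPi L (IsCMField.complexConj L) (2 + 2) (hermD L e dV hdV dW hdW) v) ∈ K₀ v}) s *
              Fn s h := by
    intro i v
    by_cases hv : v ∈ T
    · obtain ⟨Fn, h1, h2⟩ := exists_localFace L e dV hdV hdV0 dW hdW hdW0 v (νv v) (hK₀c v) (hK₀o v) (hIw v) lam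
        (G := fun s u => ((modDelta L e dV hdV dW hdW (𝒦'.pPart (locToAdelic L e dV hdV dW hdW v u)) : ℝ) : ℂ) ^ (2 * (s - 0)) * b i v u)
        (fun s => heightTwistLoc_siegel L e dV hdV hdV0 dW hdW hdW0 v 𝒦' (hb i v hv) s)
        (fun s => heightTwistLoc_smooth L e dV hdV hdV0 dW hdW hdW0 v h𝒦' (hb i v hv).2 _)
        (heightTwistLoc_flat L e dV hdV hdV0 dW hdW hdW0 v 𝒦' (hK₀K v) 0 (b i v))
      exact ⟨Fn, fun _ => ⟨h1, h2⟩⟩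
    · exact ⟨fun _ _ => 0, fun h => absurd h hv⟩
  choose Fn hFn using face
  -- THE ARCH FACES (by value)
  have arch := fun i : Fin m => hArch 𝒦' h𝒦' 0 (A i) (hAsieg i) (hfin i) (hAc i) k hk νinf
  choose hFint Ea hEad hEa using arch
  -- volumes and the scalar letters (★ E7′ at `v ∈ S`, ★ E7″ at `v ∈ T ∖ S`)
  have hmod := fun v (hv : (quadraticHeckeCharCM L).IsUnramifiedAt v) => exists_modifiedNormaliser L v hlam hv
    ((νv v).real {y : ↥(unipDeltaLoc L e dV hdV dW hdW v) | (y : UnitaryGroup.localPi L (IsCMField.complexConj L) (2 + 2) (hermD L e dV hdV dW hdW) v) ∈ K₀ v})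
  -- THE POINT CONTINUATION from the summed faces (★ p862134 §1)
  refine exists_pointContinuation_of_facesSum (Finset.univ : Finset (Fin m)) T (fun v => residueFieldCard (v.adicCompletion (Fp L)))
    (fun v _ => residueFieldCard_ne_zero _) (((2 : ℕ) : ℝ) / 2) (fun i s => Ea i s) (fun i _ => hEad i)
    (fun v s => if hv : (quadraticHeckeCharCM L).IsUnramifiedAt v then Classical.choose (hmod v hv) s else
      aNorm (Fp L) L (IsCMField.complexConj L) v 2 (fun w : PlacesOver L v => (toHeckeCharacter L lam⁻¹).localComponent w.1)
        ((νv v).real {y : ↥(unipDeltaLoc L e dV hdV dW hdW v) | (y : UnitaryGroup.localPi L (IsCMField.complexConj L) (2 + 2) (hermD L e dV hdV dW hdW) v) ∈ K₀ v}) s)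
    (fun v hv => ?_)
    (fun i v s => Fn i v s (UnitaryGroup.evalPlace (Fp L) L (IsCMField.complexConj L) (2 + 2) (hermD L e dV hdV dW hdW) v
      (UnitaryGroup.finPart (Fp L) L (IsCMField.complexConj L) (2 + 2) (hermD L e dV hdV dW hdW) k)))
    (fun i _ v hv s₁ hs₁ => ((hFn i v hv).1 s₁ hs₁ _))
    (fun s : ℂ => (partialStandardL S (fun _ => {1}) (2 * s + 1) * partialStandardL S (fun v => {(quadraticHeckeCharCM L).valueAtUniformizer v}) (2 * s + 2)) /
        (partialStandardL S (fun _ => {1}) (2 * s) * partialStandardL S (fun v => {(quadraticHeckeCharCM L).valueAtUniformizer v}) (2 * s - 1)) *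
      intertwiningDelta L e dV hdV dW hdW νN (f s) k)
    (fun s hs => ?_)
  · -- holomorphy of the scalar letters on `{0 < re}`
    by_cases hvu : (quadraticHeckeCharCM L).IsUnramifiedAt v
    · simp only [dif_pos hvu]
      exact (Classical.choose_spec (hmod v hvu)).1
    · simp only [dif_neg hvu]
      exact differentiableOn_aNorm_two_of_record_of_ramified L v hlam hvu _
  · -- THE EULER-FACE IDENTITY AT `s`
    have hs1 : 1 < s.re := by norm_num at hs; exact hs
    have hshalf : 1 / 2 < s.re := by linarith
    -- the tail `(b^S∕a^S)(s) · ∏'_{v∉T} I_v(s) = ∏_{v∈P} c_v(s)⁻¹`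
    have htail := invScalar_mul_tprod_eq_finsetProd_cm L S P hPS hs1
      (fun v => ∫ y, LambdaLoc L e dV hdV dW hdW v.1 (toHeckeCharacter L lam⁻¹) s
        (UnitaryGroup.evalPlace (Fp L) L (IsCMField.complexConj L) (2 + 2) (hermD L e dV hdV dW hdW) v.1
            (UnitaryGroup.finPart (Fp L) L (IsCMField.complexConj L) (2 + 2) (hermD L e dV hdV dW hdW) (weylDelta L e dV hdV dW hdW)) *
          (y : UnitaryGroup.localPi L (IsCMField.complexConj L) (2 + 2) (hermD L e dV hdV dW hdW) v.1)) ∂(νv v.1))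
      (fun v => hT₁ v.1 (fun h1 => ((hTSP v.1).2 v.2) (hT₁T h1)) (νv v.1) (hνK v.1) s hs1)
    rw [← tprod_subtype_congr hTSP (fun v => ∫ y, LambdaLoc L e dV hdV dW hdW v (toHeckeCharacter L lam⁻¹) s
        (UnitaryGroup.evalPlace (Fp L) L (IsCMField.complexConj L) (2 + 2) (hermD L e dV hdV dW hdW) v (UnitaryGroup.finPart (Fp L) L (IsCMField.complexConj L) (2 + 2) (hermD L e dV hdV dW hdW) (weylDelta L e dV hdV dW hdW)) * (y : UnitaryGroup.localPi L (IsCMField.complexConj L) (2 + 2) (hermD L e dV hdV dW hdW) v)) ∂(νv v))] at htail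
    -- ★ p862168: the Euler face from its letters (E3 head, E6′ slice, Fubini, arch∕local values, tail)
    have key := eulerFace_of_letters' T νinf (fun v : ↥T => νv v.1) (Finset.univ : Finset (Fin m))
      (fun (i : Fin m) (x : ↥(unipDeltaArch L e dV hdV dW hdW)) =>
        ((modDelta L e dV hdV dW hdW (𝒦'.pPart (UnitaryGroup.archToAdelic (Fp L) L (IsCMField.complexConj L) (2 + 2) (hermD L e dV hdV dW hdW)
            (UnitaryGroup.archPart (Fp L) L (IsCMField.complexConj L) (2 + 2) (hermD L e dV hdV dW hdW) (weylDelta L e dV hdV dW hdW) * (x : UnitaryGroup.arch (Fp L) L (IsCMField.complexConj L) (2 + 2) (hermD L e dV hdV dW hdW)) * UnitaryGroup.archPart (Fp L) L (IsCMField.complexConj L) (2 + 2) (hermD L e dV hdV dW hdW) k))) : ℝ) : ℂ) ^ (2 * (s - 0)) *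
          A i (UnitaryGroup.archPart (Fp L) L (IsCMField.complexConj L) (2 + 2) (hermD L e dV hdV dW hdW) (weylDelta L e dV hdV dW hdW) * (x : UnitaryGroup.arch (Fp L) L (IsCMField.complexConj L) (2 + 2) (hermD L e dV hdV dW hdW)) * UnitaryGroup.archPart (Fp L) L (IsCMField.complexConj L) (2 + 2) (hermD L e dV hdV dW hdW) k))
      (fun (i : Fin m) (v : ↥T) (y : ↥(unipDeltaLoc L e dV hdV dW hdW v.1)) =>
        ((modDelta L e dV hdV dW hdW (𝒦'.pPart (locToAdelic L e dV hdV dW hdW v.1 (UnitaryGroup.evalPlace (Fp L) L (IsCMField.complexConj L) (2 + 2) (hermD L e dV hdV dW hdW) v.1 (UnitaryGroup.finPart (Fp L) L (IsCMField.complexConj L) (2 + 2) (hermD L e dV hdV dW hdW) (weylDelta L e dV hdV dW hdW)) * (y : UnitaryGroup.localPi L (IsCMField.complexConj L) (2 + 2) (hermD L e dV hdV dW hdW) v.1) * UnitaryGroup.evalPlace (Fp L) L (IsCMField.complexConj L) (2 + 2) (hermD L e dV hdV dW hdW) v.1 (UnitaryGroup.finPart (Fp L) L (IsCMField.complexConj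 L) (2 + 2) (hermD L e dV hdV dW hdW) k)))) : ℝ) : ℂ) ^ (2 * (s - 0)) *
          b i v.1 (UnitaryGroup.evalPlace (Fp L) L (IsCMField.complexConj L) (2 + 2) (hermD L e dV hdV dW hdW) v.1 (UnitaryGroup.finPart (Fp L) L (IsCMField.complexConj L) (2 + 2) (hermD L e dV hdV dW hdW) (weylDelta L e dV hdV dW hdW)) * (y : UnitaryGroup.localPi L (IsCMField.complexConj L) (2 + 2) (hermD L e dV hdV dW hdW) v.1) * UnitaryGroup.evalPlace (Fp L) L (IsCMField.complexConj L) (2 + 2) (hermD L e dV hdV dW hdW) v.1 (UnitaryGroup.finPart (Fp L) L (IsCMField.complexConj L) (2 + 2) (hermD L e dV hdV dW hdW) k)))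
      (fun i _ => hFint i s hs1)
      (fun i _ v => integrable_localFace L e dV hdV hdV0 dW hdW hdW0 v.1 (νv v.1) lam
        (G := fun s' u => ((modDelta L e dV hdV dW hdW (𝒦'.pPart (locToAdelic L e dV hdV dW hdW v.1 u)) : ℝ) : ℂ) ^ (2 * (s' - 0)) * b i v.1 u)
        (fun s' => heightTwistLoc_siegel L e dV hdV hdV0 dW hdW hdW0 v.1 𝒦' (hb i v.1 v.2) s')
        (fun s' => heightTwistLoc_smooth L e dV hdV hdV0 dW hdW hdW0 v.1 h𝒦' (hb i v.1 v.2).2 _) hs1 (UnitaryGroup.evalPlace (Fp L) L (IsCMField.complexConj L) (2 + 2) (hermD L e dV hdV dW hdW) v.1 (UnitaryGroup.finPart (Fp L) L (IsCMField.complexConj L) (2 + 2) (hermD L e dV hdV dW hdW) k)))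
      (fun p => f s (placesEmbed L (hermD L e dV hdV dW hdW) T
        (UnitaryGroup.archPart (Fp L) L (IsCMField.complexConj L) (2 + 2) (hermD L e dV hdV dW hdW) (weylDelta L e dV hdV dW hdW) * (p.1 : UnitaryGroup.arch (Fp L) L (IsCMField.complexConj L) (2 + 2) (hermD L e dV hdV dW hdW)) * UnitaryGroup.archPart (Fp L) L (IsCMField.complexConj L) (2 + 2) (hermD L e dV hdV dW hdW) k,
          fun v : ↥T => UnitaryGroup.evalPlace (Fp L) L (IsCMField.complexConj L) (2 + 2) (hermD L e dV hdV dW hdW) v.1 (UnitaryGroup.finPart (Fp L) L (IsCMField.complexConj L) (2 + 2) (hermD L e dV hdV dW hdW) (weylDelta L e dV hdV dW hdW)) * ((p.2 v : ↥(unipDeltaLoc L e dV hdV dW hdW v.1)) : UnitaryGroup.localPi L (IsCMField.complexConj L) (2 + 2) (hermD L e dV hdV dW hdW) v.1) * UnitaryGroup.evalPlace (Fp L) L (IsCMField.complexConj L) (2 + 2) (hermD L e dV hdV dW hdW) v.1 (UnitaryGroup.finPart (Fp L) L (IsCMField.complexConj L) (2 + 2) (hermD L e dV hdV dW hdW) 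k))))
      (fun p => hslice s _ _)
      (intertwiningDelta L e dV hdV dW hdW νN (f s) k)
      (∏' v : {v : HeightOneSpectrum (𝓞 (Fp L)) // v ∉ T},
        ∫ y, LambdaLoc L e dV hdV dW hdW v.1 (toHeckeCharacter L lam⁻¹) s (UnitaryGroup.evalPlace (Fp L) L (IsCMField.complexConj L) (2 + 2) (hermD L e dV hdV dW hdW) v.1 (UnitaryGroup.finPart (Fp L) L (IsCMField.complexConj L) (2 + 2) (hermD L e dV hdV dW hdW) (weylDelta L e dV hdV dW hdW)) * (y : UnitaryGroup.localPi L (IsCMField.complexConj L) (2 + 2) (hermD L e dV hdV dW hdW) v.1)) ∂(νv v.1))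
      (hM s hs)
      (fun i => Ea i s) (fun i _ => hEa i s hs1)
      (fun v => aNorm (Fp L) L (IsCMField.complexConj L) v 2 (fun w : PlacesOver L v => (toHeckeCharacter L lam⁻¹).localComponent w.1) ((νv v).real {y : ↥(unipDeltaLoc L e dV hdV dW hdW v) | (y : UnitaryGroup.localPi L (IsCMField.complexConj L) (2 + 2) (hermD L e dV hdV dW hdW) v) ∈ K₀ v}) s)
      (fun i v => Fn i v s (UnitaryGroup.evalPlace (Fp L) L (IsCMField.complexConj L) (2 + 2) (hermD L e dV hdV dW hdW) v (UnitaryGroup.finPart (Fp L) L (IsCMField.complexConj L) (2 + 2) (hermD L e dV hdV dW hdW) k)))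
      (fun i _ v => (hFn i v.1 v.2).2 s hs1 _)
      P hPT (fun v => (((1 - ((v).residueCard : ℂ) ^ (-(2 * s))) * (1 - (quadraticHeckeCharCM L).valueAtUniformizer v * ((v).residueCard : ℂ) ^ (-(2 * s - 1)))) / ((1 - ((v).residueCard : ℂ) ^ (-(2 * s + 1))) * (1 - (quadraticHeckeCharCM L).valueAtUniformizer v * ((v).residueCard : ℂ) ^ (-(2 * s + 2))))))
      ((partialStandardL S (fun _ => {1}) (2 * s + 1) * partialStandardL S (fun v => {(quadraticHeckeCharCM L).valueAtUniformizer v}) (2 * s + 2)) / (partialStandardL S (fun _ => {1}) (2 * s) * partialStandardL S (fun v => {(quadraticHeckeCharCM L).valueAtUniformizer v}) (2 * s - 1))) htail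
    rw [key]
    refine Finset.sum_congr rfl fun i _ => ?_
    refine congrArg (fun z => Ea i s * z) (Finset.prod_congr rfl fun v hv => ?_)
    congr 1
    by_cases hvS : v ∈ S
    · have hvP : v ∉ P := fun h => hPS v h hvS
      rw [if_neg hvP, dif_neg (hram v hvS)]
    · have hvP : v ∈ P := hmemP v hv hvS
      rw [if_pos hvP, dif_pos (hur v hvS)]
      exact (Classical.choose_spec (hmod v (hur v hvS))).2 s hshalf

end Summit.HodgeConjecture.HodgeConjecture.Cruxes.HLiu418.K2LiuBigCellContinuation

end
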